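import Mathlib
import Literature.Computability.AlgebraicComplexity.StandardFamilies
import Literature.LinearAlgebra.Matrix.PermanentSubperm
import Literature.LinearAlgebra.Matrix.PermanentLaplace

/-!
# Stub `stub_substPer` for the line `pair-sacrifice` (crux `FreeSubtorus.SubtorusCovering`)

The "pair-sacrifice" substitution on the `(n' + s) × (n' + s)` generic matrix keeps the free
`n' × n'` block of variables, kills the off-diagonal blocks, and puts the identity matrix on the
sacrificed `s × s` block.  Under this substitution the generic permanent `per_{n'+s}` becomes
`per_{n'}`: re-indexing by `finSumFinEquiv : Fin n' ⊕ Fin s ≃ Fin (n' + s)` the substituted matrix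
is block upper triangular `(X 0; 0 1)`, so its permanent is `per (X) · per 1 = per_{n'}`.
-/

set_option linter.dupNamespace false

namespace Summit.ValiantsHypothesis.ValiantsHypothesis.Theorems.FreeSubtorusSubtorusCovering

open Literature.Computability.AlgebraicComplexity MvPolynomial

/-- **Pair-sacrifice substitution on the generic permanent.**  If `g` sends the free variables
`x_{(k,l)}` (`k l : Fin n'`, embedded by `Fin.castAdd s`) to themselves, the mixed entries to `0`,
and the sacrificed block (indices `Fin.natAdd n' j`) to the identity matrix, then the algebra map
`aeval g` sends `per_{n'+s}` to `per_{n'}`.  Proof: `aeval g (per_{n'+s})` is the permanent of the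
substituted matrix `(g (i, j))_{i j}`; re-indexed along `finSumFinEquiv` this matrix is
`Matrix.fromBlocks (mvPolynomialX _ _ ℂ) 0 0 1`, whose permanent is `per_{n'} · 1`
(`Matrix.permanent_submatrix_equiv`, `Matrix.permanent_fromBlocks_zero₂₁`,
`Matrix.permanent_one`). -/
theorem stub_substPer :
    ∀ (n' s : ℕ) (g : Fin (n' + s) × Fin (n' + s) → MvPolynomial (Fin n' × Fin n') ℂ),
    (∀ k l, g (Fin.castAdd s k, Fin.castAdd s l) = X (k, l)) →
    (∀ k j, g (Fin.castAdd s k, Fin.natAdd n' j) = 0) →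
    (∀ j l, g (Fin.natAdd n' j, Fin.castAdd s l) = 0) →
    (∀ j j', g (Fin.natAdd n' j, Fin.natAdd n' j') = if j = j' then 1 else 0) →
    MvPolynomial.aeval g (perPoly (Fin (n' + s)) ℂ) = perPoly (Fin n') ℂ := by
  intro n' s g h₁₁ h₁₂ h₂₁ h₂₂
  -- the substituted generic permanent is the permanent of the substituted matrix
  have hper : MvPolynomial.aeval g (perPoly (Fin (n' + s)) ℂ) =
      (Matrix.of fun i j => g (i, j)).permanent := by
    simp [perPoly, Matrix.permanent, map_sum, map_prod]
  -- re-indexed by `Fin n' ⊕ Fin s ≃ Fin (n' + s)` the substituted matrix is block triangular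
  have hsub : (Matrix.of fun i j => g (i, j)).submatrix finSumFinEquiv finSumFinEquiv =
      Matrix.fromBlocks (Matrix.mvPolynomialX (Fin n') (Fin n') ℂ) 0 0 1 := by
    ext (k | j) (l | j')
    · simp [h₁₁]
    · simp [h₁₂]
    · simp [h₂₁]
    · simp [h₂₂, Matrix.one_apply]
  rw [hper, ← Matrix.permanent_submatrix_equiv finSumFinEquiv, hsub,
    Matrix.permanent_fromBlocks_zero₂₁, Matrix.permanent_one, mul_one, perPoly]

end Summit.ValiantsHypothesis.ValiantsHypothesis.Theorems.FreeSubtorusSubtorusCovering
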